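import Literature.Probability.RandomPlanarGeometry.LoewnerLateAgreement
import Literature.Probability.RandomPlanarGeometry.HydrodynamicHeightRetention
import Literature.Analysis.SpecialFunctions.BinEntropyModulus
import HarnessLib

/-!
# Late agreement of a Loewner chain with a general initial hull of the same capacity

Topic `Literature/Probability/RandomPlanarGeometry`; theorems only. Companion of
`LoewnerLateAgreement.lean` (two Loewner chains whose drivers agree after a short time `t`). Here
the initial piece `g_t = map V t` of the chain of a continuous driver `V` is compared with the
hydrodynamic map `g_K = hydroFun K` of an ARBITRARY bounded hull `K ∈ 𝒬` of the same capacity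
`hcap(K) = 2t`, both followed by the same outer Loewner map `h = g^{V(t+·)}_u`:

  `G₁ = g^V_{t+u} = h ∘ g_t`   versus   `G₂ = h ∘ g_K`.

At a point `z` with `16 (t + u) ≤ (Im z)²` and `1400 t ≤ (Im z)²`:

* `Loewner.abs_log_derivRatio_sub_log_hull_le` — **`|log ψ^V_{t+u}(z) - log (Im z |G₂'(z)|/Im G₂(z))| ≤ 1700 t/(Im z)²`**;
* `Loewner.abs_re_unit_map_sub_re_unit_hull_le` — for every real base point `x`,
  `|Re Z₁/|Z₁| - Re Z₂/|Z₂|| ≤ 1400 t/(Im z)²`, `Zᵢ = Gᵢ(z) - x`;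
* `Loewner.norm_map_sub_hull_comp_le` — `‖G₁(z) - G₂(z)‖ ≤ 700 t/Im z`;
* `Loewner.abs_roomFunctional_map_sub_hull_le` — the combination `log ψ + 3 H(S)` (binary entropy
  `H`, `S = (1 + Re Z/|Z|)/2` from the base point `V_{t+u}`) differs by
  `≤ 1700 t/Y² + 2100 (t/Y²)(1 - log (700 t/Y²))` (`BinEntropyModulus`).

The inner maps are `7t/Im z`-close (`ShortTime.norm_map_sub_self_le` and the capacity displacement
bound for general hulls, `IsHydrodynamicMap.norm_sub_self_le_two_mul_hcap_div_im`), have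
`log`-derivatives `O(t/(Im z)²)` (`ShortTime.abs_log_norm_deriv_map_le`,
`IsHydrodynamicMap.abs_log_norm_deriv_le`), and the outer map is univalent into `ℍ` on
`B(g_K z, Im z/6)` (Koebe bounds of `UnivalentNearbyPoints.lean`). This is the deterministic core
of the fidelity of lattice drivers whose microscopic initial hull (small capacity, any diameter) is
replaced by a vertical slit: with `V = U (· ∸ t)`, `h = g^U_u` and `g_{K_k} = g^U_u ∘ g_{K_j}`.

## References

* G. F. Lawler, *Conformally Invariant Processes in the Plane*, AMS (2005), §3.4 Prop. 3.36, Ch. 4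
  §4.1, Rem. 4.9 [Lawler2005].
-/

noncomputable section

open Set Filter MeasureTheory Metric Complex
open _root_.Topology
open UpperHalfPlane (upperHalfPlaneSet isOpen_upperHalfPlaneSet)
open Literature.Analysis.Complex
open scoped NNReal

namespace Literature.Probability.RandomPlanarGeometry

namespace Loewner

section HullLateAgree

/-! Throughout: `V` continuous, `K` a bounded hull of capacity `2t`, `z ∈ ℍ` with
`16 (t + u) ≤ (Im z)²` and `1400 t ≤ (Im z)²`. -/

variable {V : ℝ≥0 → ℝ} {K : Set ℂ} {z : ℂ} {t u : ℝ≥0} (hV : Continuous V) (hK : IsBoundedHull K)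
  (hcapK : hcapOf K = 2 * t) (hz : 0 < z.im) (h16 : 16 * ((t : ℝ) + u) ≤ z.im ^ 2)
  (hs : 1400 * (t : ℝ) ≤ z.im ^ 2)

include hK hcapK in
/-- `hcap K (hydroEquiv K _) = 2t`. [folklore] -/
theorem hcap_hydroEquiv_eq : hcap K (hydroEquiv K hK.hasHydroMap) = 2 * t := by
  rw [← hcapOf_of_hasHydroMap hK.hasHydroMap, hcapK]

include hK hcapK hz hs in
/-- The point is off the hull (`2 hcap < (Im z)²`). [folklore] -/
theorem mem_diff_hull : z ∈ upperHalfPlaneSet \ K :=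
  IsHydrodynamicMap.mem_diff_of_two_mul_hcap_lt hK (isHydrodynamicMap_hydroEquiv hK.hasHydroMap) hz
    (by rw [hcap_hydroEquiv_eq hK hcapK]; nlinarith [t.coe_nonneg])

include hK hcapK hz hs in
/-- **The general inner map is `4t/Im z`-close to the identity.** [cite: Lawler2005, §3.4 Prop. 3.36] -/
theorem norm_hydroFun_sub_self_le : ‖hydroFun K z - z‖ ≤ 4 * t / z.im := by
  have hφ := isHydrodynamicMap_hydroEquiv hK.hasHydroMap
  have h4 : 4 * hcap K (hydroEquiv K hK.hasHydroMap) < z.im ^ 2 := by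
    rw [hcap_hydroEquiv_eq hK hcapK]; nlinarith [t.coe_nonneg]
  have h := hφ.norm_sub_self_le_two_mul_hcap_div_im hK hz h4
  rw [hydroFun_apply hK.hasHydroMap (mem_diff_hull hK hcapK hz hs), hcap_hydroEquiv_eq hK hcapK] at *
  calc _ ≤ 2 * (2 * t) / z.im := h
    _ = 4 * t / z.im := by ring

include hK hcapK hz hs in
/-- **The general inner map keeps `3/4` of the height**: `3 Im z/4 ≤ Im g_K(z)`.
[cite: Lawler2005, §3.4 (3.7) with Thm. 4.6] -/
theorem im_hydroFun_lower : 3 * z.im / 4 ≤ (hydroFun K z).im := by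
  have hφ := isHydrodynamicMap_hydroEquiv hK.hasHydroMap
  have h4 : 4 * hcap K (hydroEquiv K hK.hasHydroMap) < z.im ^ 2 := by
    rw [hcap_hydroEquiv_eq hK hcapK]; nlinarith [t.coe_nonneg]
  have h := hφ.im_sub_le_im hK hz h4
  rw [hydroFun_apply hK.hasHydroMap (mem_diff_hull hK hcapK hz hs), hcap_hydroEquiv_eq hK hcapK] at *
  have h2 : 2 * (2 * (t : ℝ)) / z.im ≤ z.im / 4 := by
    rw [div_le_div_iff₀ hz (by norm_num)]; nlinarith [t.coe_nonneg]
  linarith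

include hK hcapK hz hs in
/-- `hydroFun K` is differentiable at `z` with the derivative of the conformal map. [folklore] -/
theorem hasDerivAt_hydroFun :
    HasDerivAt (hydroFun K) (deriv (hydroEquiv K hK.hasHydroMap) z) z := by
  have hmem := mem_diff_hull hK hcapK hz hs
  have hopen : IsOpen (upperHalfPlaneSet \ K) :=
    IsHydrodynamicMap.isOpen_diff (hydroEquiv K hK.hasHydroMap)
  have hd : DifferentiableAt ℂ (hydroEquiv K hK.hasHydroMap) z :=
    (hydroEquiv K hK.hasHydroMap).differentiableOn_coe.differentiableAt (hopen.mem_nhds hmem)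
  have hev : hydroFun K =ᶠ[𝓝 z] hydroEquiv K hK.hasHydroMap :=
    Filter.eventuallyEq_of_mem (hopen.mem_nhds hmem) fun w hw ↦ hydroFun_apply hK.hasHydroMap hw
  exact hd.hasDerivAt.congr_of_eventuallyEq hev

include hK hcapK hz hs in
/-- **`|log |g_K'(z)|| ≤ 44 t/(Im z)²`.** [cite: Lawler2005, §3.4 Prop. 3.36] -/
theorem abs_log_norm_deriv_hydroFun_le : |Real.log ‖deriv (hydroFun K) z‖| ≤ 44 * t / z.im ^ 2 := by
  have hφ := isHydrodynamicMap_hydroEquiv hK.hasHydroMap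
  have h32 : 32 * hcap K (hydroEquiv K hK.hasHydroMap) ≤ z.im ^ 2 := by
    rw [hcap_hydroEquiv_eq hK hcapK]; nlinarith [t.coe_nonneg]
  have h := hφ.abs_log_norm_deriv_le hK hz h32
  rw [(hasDerivAt_hydroFun hK hcapK hz hs).deriv, hcap_hydroEquiv_eq hK hcapK] at *
  calc _ ≤ 22 * (2 * t) / z.im ^ 2 := h
    _ = 44 * t / z.im ^ 2 := by ring

include hV hK hcapK hz hs in
/-- **The two inner points are close**, in units of the radius `Im z/6`:
`‖g_t z - g_K z‖ ≤ 7t/Im z = (42 t/(Im z)²)(Im z/6)`. [folklore] -/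
theorem norm_map_sub_hydroFun_le : ‖map V t z - hydroFun K z‖ ≤ 42 * t / z.im ^ 2 * (z.im / 6) := by
  have hT : ShortTime V z t := ⟨hV, hz, by nlinarith [hs, t.coe_nonneg]⟩
  have h1 := hT.norm_map_sub_self_le
  have h2 := norm_hydroFun_sub_self_le hK hcapK hz hs
  calc ‖map V t z - hydroFun K z‖ = ‖(map V t z - z) - (hydroFun K z - z)‖ := by ring_nf
    _ ≤ ‖map V t z - z‖ + ‖hydroFun K z - z‖ := norm_sub_le _ _
    _ ≤ 3 * t / z.im + 4 * t / z.im := add_le_add h1 h2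
    _ = 42 * t / z.im ^ 2 * (z.im / 6) := by field_simp; ring

include hz hs in
/-- The relative closeness parameter is small: `42 t/(Im z)² ≤ 1/32`. [folklore] -/
theorem rho_hull_le : 42 * (t : ℝ) / z.im ^ 2 ≤ 1 / 32 := by
  rw [div_le_div_iff₀ (by positivity) (by norm_num)]
  nlinarith [hs, NNReal.coe_nonneg t]

include hV hK hcapK hz h16 hs in
/-- **The outer map `g^{V(t+·)}_u` is univalent into `ℍ` on `B(g_K z, Im z/6)`** (the disc has
`Im > Im z/2 ≥ 2√u`). [folklore] -/
theorem univalent_shift_ball_hull :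
    DifferentiableOn ℂ (map (fun v ↦ V (t + v)) u) (ball (hydroFun K z) (z.im / 6)) ∧
    InjOn (map (fun v ↦ V (t + v)) u) (ball (hydroFun K z) (z.im / 6)) ∧
    MapsTo (map (fun v ↦ V (t + v)) u) (ball (hydroFun K z) (z.im / 6)) upperHalfPlaneSet := by
  have hc := continuous_shift V hV t
  have him := im_hydroFun_lower hK hcapK hz hs
  have hB : ball (hydroFun K z) (z.im / 6) ⊆ domain (fun v ↦ V (t + v)) u := by
    intro ζ hζ
    rw [Metric.mem_ball, dist_eq_norm] at hζ
    have hζim : z.im / 2 < ζ.im := by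
      have h6 := abs_im_le_norm (ζ - hydroFun K z)
      have h7 := neg_abs_le (ζ - hydroFun K z).im
      rw [sub_im] at h6 h7
      linarith
    have hζpos : 0 < ζ.im := by linarith
    refine (mem_domain_iff _ _ _).2 ⟨hζpos, lt_swallowingTime_of_four_mul_lt hc hζpos ?_⟩
    nlinarith [h16, t.coe_nonneg]
  exact ⟨(differentiableOn_map_of_lt_swallowingTime hc u).mono fun _ hζ ↦ ((mem_domain_iff _ _ _).1 (hB hζ)).2,
    (injOn_map_of_lt_swallowingTime hc u).mono fun _ hζ ↦ ((mem_domain_iff _ _ _).1 (hB hζ)).2,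
    fun _ hζ ↦ mapsTo_map hc u (hB hζ)⟩

include hV hK hcapK hz h16 hs

/-- **Late agreement with a general initial hull, conformal-radius part**:
`|log ψ^V_{t+u}(z) - log (Im z · |(h ∘ g_K)'(z)| / Im h(g_K z))| ≤ 1700 t/(Im z)²`, `h = g^{V(t+·)}_u`.
[cite: Lawler2005, Ch. 4 §4.1 with Rem. 4.9 and §3.4 Prop. 3.36] -/
theorem abs_log_derivRatio_sub_log_hull_le :
    |Real.log (derivRatio V z (t + u)) -
      Real.log (z.im * ‖deriv (fun w ↦ map (fun v ↦ V (t + v)) u (hydroFun K w)) z‖ /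
        (map (fun v ↦ V (t + v)) u (hydroFun K z)).im)| ≤ 1700 * t / z.im ^ 2 := by
  have hR : 0 < z.im / 6 := by positivity
  have hst : t ≤ t + u := le_self_add
  have h16' : 16 * ((t + u : ℝ≥0) : ℝ) ≤ z.im ^ 2 := by push_cast; exact h16
  obtain ⟨hd, hi, hm⟩ := univalent_shift_ball_hull hV hK hcapK hz h16 hs
  have hnear := norm_map_sub_hydroFun_le hV hK hcapK hz hs
  have hρ := rho_hull_le hz hs
  set hmap := map (fun v ↦ V (t + v)) u with hh
  have htsub : t + u - t = u := add_tsub_cancel_left t u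
  -- the four estimates
  have hA := abs_log_norm_deriv_sub_le hR hd hi hnear (hρ.trans (by norm_num))
  have hB := abs_log_im_sub_log_im_le hR hd hi hm hnear hρ
  have hTs : ShortTime V z t := (shortTime_of_sixteen_mul_le hV hz h16').mono hst
  have hC := hTs.abs_log_norm_deriv_map_le
  have hC' := abs_log_norm_deriv_hydroFun_le hK hcapK hz hs
  -- positivity of the factors
  have hmem : map V t z ∈ ball (hydroFun K z) (z.im / 6) := mem_ball_of_norm_sub_le hR hnear hρ
  have hpos1 : 0 < (hmap (map V t z)).im := hm hmem
  have hpos2 : 0 < (hmap (hydroFun K z)).im := hm (mem_ball_self hR)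
  have hd1 : 0 < ‖deriv (map V t) z‖ := hTs.norm_deriv_map_pos
  have hd2 : 0 < ‖deriv (hydroFun K) z‖ := by
    rw [(hasDerivAt_hydroFun hK hcapK hz hs).deriv]
    have hopen : IsOpen (upperHalfPlaneSet \ K) :=
      IsHydrodynamicMap.isOpen_diff (hydroEquiv K hK.hasHydroMap)
    obtain ⟨r, hr, hball⟩ := Metric.isOpen_iff.1 hopen z (mem_diff_hull hK hcapK hz hs)
    exact norm_deriv_pos_of_injOn hr
      ((hydroEquiv K hK.hasHydroMap).differentiableOn_coe.mono hball)
      ((hydroEquiv K hK.hasHydroMap).injOn.mono hball)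
  have hod : ∀ ζ ∈ ball (hydroFun K z) (z.im / 6), 0 < ‖deriv hmap ζ‖ := by
    intro ζ hζ
    have hsub : ball ζ (z.im / 6 - dist ζ (hydroFun K z)) ⊆ ball (hydroFun K z) (z.im / 6) :=
      ball_subset_ball' (by linarith)
    have hr : 0 < z.im / 6 - dist ζ (hydroFun K z) := by rw [Metric.mem_ball] at hζ; linarith
    exact norm_deriv_pos_of_injOn hr (hd.mono hsub) (hi.mono hsub)
  have ho1 : 0 < ‖deriv hmap (map V t z)‖ := hod _ hmem
  have ho2 : 0 < ‖deriv hmap (hydroFun K z)‖ := hod _ (mem_ball_self hR)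
  -- chain rules
  have e1 : Real.log (derivRatio V z (t + u)) = Real.log z.im + Real.log ‖deriv hmap (map V t z)‖ +
      Real.log ‖deriv (map V t) z‖ - Real.log (hmap (map V t z)).im := by
    rw [derivRatio_eq_shift hV hz hst h16', htsub, Real.log_div (by positivity) hpos1.ne',
      Real.log_mul (by positivity) (by positivity), Real.log_mul ho1.ne' hd1.ne']
    ring
  have hG : deriv (fun w ↦ hmap (hydroFun K w)) z = deriv hmap (hydroFun K z) * deriv (hydroFun K) z := by
    have h2 : DifferentiableAt ℂ hmap (hydroFun K z) := hd.differentiableAt (ball_mem_nhds _ hR)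
    exact (h2.hasDerivAt.comp z (hasDerivAt_hydroFun hK hcapK hz hs).differentiableAt.hasDerivAt).deriv
  have e2 : Real.log (z.im * ‖deriv (fun w ↦ hmap (hydroFun K w)) z‖ / (hmap (hydroFun K z)).im) =
      Real.log z.im + Real.log ‖deriv hmap (hydroFun K z)‖ + Real.log ‖deriv (hydroFun K) z‖ -
      Real.log (hmap (hydroFun K z)).im := by
    rw [hG, norm_mul, Real.log_div (by positivity) hpos2.ne', Real.log_mul (by positivity)
      (by positivity), Real.log_mul ho2.ne' hd2.ne']
    ring
  rw [e1, e2]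
  set A := Real.log ‖deriv hmap (map V t z)‖ - Real.log ‖deriv hmap (hydroFun K z)‖ with hAdef
  set B := Real.log ‖deriv (map V t) z‖ with hBdef
  set C := Real.log ‖deriv (hydroFun K) z‖ with hCdef
  set D := Real.log (hmap (map V t z)).im - Real.log (hmap (hydroFun K z)).im with hDdef
  have key : |A| + |B| + |C| + |D| ≤ 1700 * t / z.im ^ 2 := by
    have : 7 * (42 * (t : ℝ) / z.im ^ 2) + 9 * t / (2 * z.im ^ 2) + 44 * t / z.im ^ 2 +
        32 * (42 * (t : ℝ) / z.im ^ 2) ≤ 1700 * t / z.im ^ 2 := by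
      rw [show 7 * (42 * (t : ℝ) / z.im ^ 2) + 9 * t / (2 * z.im ^ 2) + 44 * t / z.im ^ 2 +
        32 * (42 * (t : ℝ) / z.im ^ 2) = (3373 / 2) * t / z.im ^ 2 by field_simp; ring]
      gcongr; norm_num
    linarith [hA, hB, hC, hC']
  have hx : Real.log z.im + Real.log ‖deriv hmap (map V t z)‖ + Real.log ‖deriv (map V t) z‖ -
      Real.log (hmap (map V t z)).im - (Real.log z.im + Real.log ‖deriv hmap (hydroFun K z)‖ +
      Real.log ‖deriv (hydroFun K) z‖ - Real.log (hmap (hydroFun K z)).im) = A + B - C - D := by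
    rw [hAdef, hBdef, hCdef, hDdef]; ring
  rw [hx]
  calc |A + B - C - D| ≤ |A + B - C| + |D| := abs_sub _ _
    _ ≤ |A + B| + |C| + |D| := by gcongr; exact abs_sub _ _
    _ ≤ |A| + |B| + |C| + |D| := by gcongr; exact abs_add_le _ _
    _ ≤ 1700 * t / z.im ^ 2 := key

/-- **Late agreement with a general initial hull, direction part**: for every real base point `x`,
`|Re Z₁/|Z₁| - Re Z₂/|Z₂|| ≤ 1400 t/(Im z)²`, `Z₁ = g^V_{t+u}(z) - x`, `Z₂ = h(g_K z) - x`.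
[cite: Lawler2005, Ch. 4 §4.1 with Rem. 4.9 and §3.4 Prop. 3.36] -/
theorem abs_re_unit_map_sub_re_unit_hull_le (x : ℝ) :
    |(map V (t + u) z - x).re / ‖map V (t + u) z - x‖ -
      (map (fun v ↦ V (t + v)) u (hydroFun K z) - x).re /
        ‖map (fun v ↦ V (t + v)) u (hydroFun K z) - x‖| ≤ 1400 * t / z.im ^ 2 := by
  have hR : 0 < z.im / 6 := by positivity
  have h16' : 16 * ((t + u : ℝ≥0) : ℝ) ≤ z.im ^ 2 := by push_cast; exact h16
  obtain ⟨hd, hi, hm⟩ := univalent_shift_ball_hull hV hK hcapK hz h16 hs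
  have h1 := abs_re_unit_sub_re_unit_le hR hd hi hm (norm_map_sub_hydroFun_le hV hK hcapK hz hs)
    (rho_hull_le hz hs) x
  have e1 : map V (t + u) z = map (fun v ↦ V (t + v)) u (map V t z) := by
    rw [map_eq_map_shift_map hV hz le_self_add h16', add_tsub_cancel_left]
  rw [e1]
  calc _ ≤ 32 * (42 * t / z.im ^ 2) := h1
    _ = 1344 * t / z.im ^ 2 := by ring
    _ ≤ 1400 * t / z.im ^ 2 := by gcongr; norm_num

/-- **Late agreement with a general initial hull, the maps**: `‖g^V_{t+u}(z) - h(g_K z)‖ ≤ 700 t/Im z`.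
[folklore] -/
theorem norm_map_sub_hull_comp_le :
    ‖map V (t + u) z - map (fun v ↦ V (t + v)) u (hydroFun K z)‖ ≤ 700 * t / z.im := by
  have hR : 0 < z.im / 6 := by positivity
  have h16' : 16 * ((t + u : ℝ≥0) : ℝ) ≤ z.im ^ 2 := by push_cast; exact h16
  obtain ⟨hd, hi, hm⟩ := univalent_shift_ball_hull hV hK hcapK hz h16 hs
  have h1 := norm_sub_le_mul_im hR hd hi hm (norm_map_sub_hydroFun_le hV hK hcapK hz hs)
    (rho_hull_le hz hs)
  have e1 : map V (t + u) z = map (fun v ↦ V (t + v)) u (map V t z) := by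
    rw [map_eq_map_shift_map hV hz le_self_add h16', add_tsub_cancel_left]
  -- `Im h(g_K z) ≤ Im g_K z ≤ Im z`
  have him : (map (fun v ↦ V (t + v)) u (hydroFun K z)).im ≤ z.im := by
    have hmemK := mem_diff_hull hK hcapK hz hs
    have h2 : (hydroFun K z).im ≤ z.im := by
      rw [hydroFun_apply hK.hasHydroMap hmemK]
      exact (isHydrodynamicMap_hydroEquiv hK.hasHydroMap).im_le (hK.1.subset inter_subset_left) hmemK
    have him3 := im_hydroFun_lower hK hcapK hz hs
    have hpos : 0 < (hydroFun K z).im := by linarith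
    have h4 : 4 * (u : ℝ) < (hydroFun K z).im ^ 2 := by nlinarith [h16, t.coe_nonneg]
    have hT := lt_swallowingTime_of_four_mul_lt (continuous_shift V hV t) hpos h4
    exact (im_map_le (continuous_shift V hV t) hpos hT).trans h2
  rw [e1]
  calc _ ≤ 16 * (42 * t / z.im ^ 2) * (map (fun v ↦ V (t + v)) u (hydroFun K z)).im := h1
    _ ≤ 16 * (42 * t / z.im ^ 2) * z.im := by gcongr
    _ = 672 * t / z.im := by field_simp; ring
    _ ≤ 700 * t / z.im := by gcongr; norm_num

/-- **Late agreement with a general initial hull, room–entropy combination**: with `S = (1 + Re Z/|Z|)/2`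
read from the base point `V_{t+u}` and `H` the binary entropy,
`|[log ψ^V_{t+u} + 3 H(S₁)] - [log ψ₂ + 3 H(S₂)]| ≤ 1700 t/Y² + 2100 (t/Y²) (1 - log (700 t/Y²))`
(`|H p - H q| ≤ d (1 - log d)` for `|p - q| ≤ d`, `BinEntropyModulus`). [folklore] -/
theorem abs_roomFunctional_map_sub_hull_le :
    |(Real.log (derivRatio V z (t + u)) + 3 * Real.binEntropy (schrammObs V z (t + u))) -
      (Real.log (z.im * ‖deriv (fun w ↦ map (fun v ↦ V (t + v)) u (hydroFun K w)) z‖ /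
          (map (fun v ↦ V (t + v)) u (hydroFun K z)).im) +
        3 * Real.binEntropy ((1 + (map (fun v ↦ V (t + v)) u (hydroFun K z) - V (t + u)).re /
          ‖map (fun v ↦ V (t + v)) u (hydroFun K z) - V (t + u)‖) / 2))| ≤
      1700 * t / z.im ^ 2 + 2100 * (t / z.im ^ 2) * (1 - Real.log (700 * t / z.im ^ 2)) := by
  have h1 := abs_log_derivRatio_sub_log_hull_le hV hK hcapK hz h16 hs
  have h2 := abs_re_unit_map_sub_re_unit_hull_le hV hK hcapK hz h16 hs (V (t + u))
  set G := map (fun v ↦ V (t + v)) u (hydroFun K z) with hG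
  -- the two Schramm values lie in `[0, 1]` and differ by `≤ 350 t/Y²`
  have hmem : ∀ Z : ℂ, (1 + Z.re / ‖Z‖) / 2 ∈ Icc (0 : ℝ) 1 := by
    intro Z
    have h : |Z.re / ‖Z‖| ≤ 1 := by
      rcases eq_or_ne Z 0 with h0 | h0
      · simp [h0]
      · rw [abs_div, abs_norm, div_le_one (norm_pos_iff.2 h0)]
        exact Complex.abs_re_le_norm _
    have h' := abs_le.1 h
    constructor <;> linarith [h'.1, h'.2]
  have hS : |schrammObs V z (t + u) - (1 + (G - V (t + u)).re / ‖G - V (t + u)‖) / 2| ≤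
      700 * t / z.im ^ 2 := by
    simp only [schrammObs, centredMap_apply]
    rw [show ∀ a b : ℝ, (1 + a) / 2 - (1 + b) / 2 = (a - b) / 2 from fun a b ↦ by ring, abs_div,
      abs_two, div_le_iff₀ (by norm_num : (0:ℝ) < 2)]
    calc _ ≤ 1400 * t / z.im ^ 2 := h2
      _ = 700 * t / z.im ^ 2 * 2 := by ring
  have hd1 : 700 * (t : ℝ) / z.im ^ 2 ≤ 1 := by
    rw [div_le_one (by positivity)]; nlinarith [hs, t.coe_nonneg]
  have hH := Literature.Analysis.SpecialFunctions.Real.abs_binEntropy_sub_binEntropy_le_of_le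
    (schrammObs_mem_Icc V z (t + u)) (hmem (G - V (t + u))) hS hd1
  have hsplit : ∀ a b c d : ℝ, |(a + 3 * b) - (c + 3 * d)| ≤ |a - c| + 3 * |b - d| := by
    intro a b c d
    calc |(a + 3 * b) - (c + 3 * d)| = |(a - c) + 3 * (b - d)| := by ring_nf
      _ ≤ |a - c| + |3 * (b - d)| := abs_add_le _ _
      _ = |a - c| + 3 * |b - d| := by rw [abs_mul, abs_of_pos (by norm_num : (0:ℝ) < 3)]
  refine (hsplit _ _ _ _).trans ?_
  have : 3 * (700 * (t : ℝ) / z.im ^ 2 * (1 - Real.log (700 * t / z.im ^ 2))) =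
      2100 * (t / z.im ^ 2) * (1 - Real.log (700 * t / z.im ^ 2)) := by ring
  linarith [h1, hH]

end HullLateAgree

end Loewner

end Literature.Probability.RandomPlanarGeometry

end
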